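import Summits.BirchSwinnertonDyer.Rank1Residual.Additive.TameBranchKatoDivisibility
import Summits.BirchSwinnertonDyer.Rank1Residual.Additive.CongruentPartnerMainConjecture
import Summits.BirchSwinnertonDyer.Rank1Residual.X11a.MuLambdaSplit
import HarnessLib

/-!
# The RATIONAL λ-squeeze on the tame branch: Kato's half `char X ∣ p^k·B` + `μ(X) = 0` + ONE unit
# coefficient of `B` at index `n` + the lower bound `n ≤ λ(X)` ⟹ `char_Λ X(E/ℚ_∞) = (B)` INTEGRALLY,
# `λ(X) = n`, and BOTH `T = 0` halves — the kernel form of route planner 2's ST-25.3 (team n1011; lane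
# CLASS-CLOSURE, seat cc-typer-2 = typer of record N10 §3.2 / O7 §3.3)

HONEST FRAMING (cell `b2b-bsdres`, run/shared/lean/b2b/bsd-rank1-residual/, verbatim in every
file): the goal of the cell is to DELETE the COMBINATION-SHAPED residual classes of the
Birch–Swinnerton-Dyer formula for ALL analytic-rank `≤ 1` elliptic curves over `ℚ` — "full BSD
formula for every rank `≤ 1` curve in class `C`" assembled STRICTLY from published theorems — so
that the rank-`≤ 1` remainder becomes exactly the CONSTRUCTION-SHAPED classes, which are TYPED
(missing-input `Prop`s), NOT attempted. This is not "finishing BSD". Lane CLASS-CLOSURE: prove what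
is provable now; shrink each hard class to its core with data; no claim beyond stated classes;
census / instrument output = EVIDENCE, never a Literature fact; RESIDUAL-MAP marks N10 / N11 / O7
UNCHANGED; nothing is booked by this file. THEOREMS ONLY: 0 definitions, 0 named facts, 0
conjecture nodes.

## What (route planner 2, `cells/n1011/ROUTE-2.md` §II.25 ST-25.3; reading of record
`class-closure/N10/E346-KATO-INT-typer2.md` §ST-25.3, cc-typer-2 GEN 9)

On the (G-ord) rows of semistability defect `e ∈ {3,4,6}` (N10 `CellGordHigher`, O7-ord twin) the
printed route to the cyclotomic main conjecture for `X(E/ℚ_∞)` (Delbourgo 1998 / 2002) delivers the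
Kato half only RATIONALLY: `p^k · B_E ∈ ι(char_Λ X)` — the tree's typed input
`TameBranchRatDvdAt W p` (`TameBranchKatoDivisibility.lean`; Delbourgo 2002 Thm. (C)), with `B_E` the
E-normalised tame branch `IsTameBranchOf f p ε α B`. A RATIONAL divisibility bounds `λ`
(`lam_le_of_dvd_of_iota_eq_C_pow_mul`: one unit coefficient `‖[Tⁿ]B‖_p = 1` gives `λ(X) ≤ n`) but
never `μ`. The defect-2 squeeze `budgetSqueeze` (`CongruentPartnerMainConjecture.lean`) closes the
main conjecture from an INTEGRAL divisibility because there `μ = 0` is forced; on `e ∈ {3,4,6}` the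
`μ = 0` input must come from OUTSIDE (the "μ-anchor": a congruence link to a `μ = 0` partner through
Greenberg–Vatsal, `ClassX4Gord./ClassX3Gord.mu_eq_zero_of_gv_…`). THIS FILE is the missing algebra:

* §1 (Λ-algebra, Gauss' lemma for `p ∈ Λ`): `fE` of unit content and `fE ∣ p^k · g₀` ⟹ `fE ∣ g₀`
  (`dvd_of_dvd_C_pow_mul_of_hasUnitContent`; `p` is prime in `Λ`, `IwasawaAlgebra.prime_C`), hence the
  RATIONAL λ-squeeze `span_eq_span_of_dvd_C_pow_mul_of_lam_le`.
* §2 (per datum, cell-agnostic over `SelmerDualData`): `μ(D.X) = 0`, `g ∈ char X` with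
  `ι g = p^k · B`, `B` `p`-integral with `‖[Tⁿ]B‖_p = 1`, and `n ≤ λ(D.X)` ⟹ `B = ι g₀` with
  `char X = (g₀)` and `λ(X) = n` (`exists_charIdeal_eq_span_of_ratDvd_of_cert_of_mu_zero_of_le`); the
  BUDGET form takes `n ≤ λ` from the typed per-curve input `BudgetLeLambdaAt p W n` (K-F₀).
* §3 (the tame branch): with `TameBranchRatDvdAt W p` and a tame-branch tuple this is the per-datum
  conclusion of the cell's typed rational main conjecture `TameBranchRatCharEqAt` WITH EXPONENT
  `k = 0` — `char_Λ X(W/ℚ_∞) = (g₀)`, `ι g₀ = B` — from: Kato's half, ONE unit coefficient, the budget,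
  the μ-anchor (`tameBranch_charIdeal_eq_span_of_ratDvd_of_cert_of_budget_of_mu_zero`).
* §4 (`T = 0`, both halves at the datum): every `c ∈ char X` has `c(0) ∈ ℤ_p · B(0)` and some
  `c ∈ char X` has `c(0) = B(0) = α⁻¹[0]⁺_f` (`IsTameBranchOf.constantCoeff`); with the period binders
  of `TameBranchLower` (`α⁻¹[0]⁺_f = z₀·q`, `L(E,1) = q·Ω_E`) resp. its unit form this is the LOWER
  resp. UPPER `T = 0` divisibility AT THE DATUM, i.e. the `D`-instances of `CycLeadingTermDvdAt` /
  `CycLeadingTermAt`.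

Reading (EVIDENCE for RESIDUAL-MAP wording; nothing moved): on e346 rows the μ-ANCHOR is load-bearing
for the WHOLE printed route at `T = 0` (not only for its upper half) — WITHOUT `μ(X) = 0` nothing
beyond `λ(X) ≤ n` follows from a rational divisibility (`E346-KATO-INT-typer2.md` §ST-25.3). CUSTOMERS
today: none instantiated — the unit-coefficient certificate at `e ≥ 3` wants a tame-branch engine for
the coefficients of `B` (cc-eng-3's ENG-D computes the interpolation DATA at levels `p², p³`,
two-engine, not yet `[Tⁿ]B`); the μ-anchor wants an S3/S4-matchable congruence link to a `μ = 0`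
partner + A240. What is NOT claimed: any per-pair binder; `TameBranchRatCharEqAt W p` itself (a
statement over ALL tuples and data — here one tuple, one datum at a time); anything at `p = 2`;
nothing booked.

References: L. Washington, GTM 83, §7.1, §13.2 [Washington1997]; R. Greenberg, V. Vatsal, Invent.
Math. 142 (2000) p. 2–4 [GreenbergVatsal2000]; D. Delbourgo, Compositio 113 (1998) Main Conjecture
p. 151, J. Number Theory 95 (2002) Thm. (C) [Delbourgo1998, Delbourgo2002]; M. Emerton, R. Pollack,
T. Weston, Invent. Math. 163 (2006) Cor. 3.2.5 / Thm. 3.1.1 (shape of the budget input)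
[EmertonPollackWeston2006].
-/

set_option autoImplicit false

noncomputable section

open scoped Classical MatrixGroups ModularForm NumberField

open CongruenceSubgroup WeierstrassCurve NumberField Literature.NumberTheory.EllipticCurves
  Literature.NumberTheory.EllipticCurves.ModularForms
  Literature.NumberTheory.EllipticCurves.Rank1Residual
  Literature.NumberTheory.EllipticCurves.Rank1Residual.Typed
  Literature.NumberTheory.EllipticCurves.GreenbergVatsal2000
  Summit.BirchSwinnertonDyer.Rank1Residual.X1.MuLambda
  Summit.BirchSwinnertonDyer.Rank1Residual.X1.ParitySqueeze
  Summit.BirchSwinnertonDyer.Rank1Residual.X11a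
  Summit.BirchSwinnertonDyer.Rank1Residual.X11a.LambdaNorm
  Summit.BirchSwinnertonDyer.Rank1Residual.Iwasawa
  IsDedekindDomain

open Summit.BirchSwinnertonDyer.Rank1Residual.X1.MuPart (mu_generator_eq_muInvariant)
open Summit.BirchSwinnertonDyer.Rank1Residual.X1.ParitySqueeze (lam_generator_eq_lambdaInvariant)

namespace Summit.BirchSwinnertonDyer.Rank1Residual.Additive

variable {p : ℕ} [hp : Fact p.Prime]

/-! ### §1 Λ-algebra: Gauss' lemma for `p ∈ Λ` and the RATIONAL λ-squeeze -/

/-- **Gauss' lemma for the prime `p ∈ Λ = ℤ_p⟦T⟧`**: an element `f` of unit content (`p ∤ f`,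
`μ(f) = 0`) dividing `p^k · g₀` divides `g₀` (`p` is a prime element of `Λ`, `IwasawaAlgebra.prime_C`;
induction on `k`). [cite: Washington1997, §13.1 (Λ/(p) ≅ 𝔽_p⟦T⟧), §7.1] -/
theorem dvd_of_dvd_C_pow_mul_of_hasUnitContent {f g₀ : IwasawaAlgebra p} (hf : HasUnitContent f)
    (k : ℕ) (h : f ∣ PowerSeries.C ((p : ℤ_[p]) ^ k) * g₀) : f ∣ g₀ := by
  induction k generalizing g₀ with
  | zero => simpa using h
  | succ k ih =>
    obtain ⟨c, hc⟩ := h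
    -- `p ∣ f·c`, `p ∤ f` ⟹ `p ∣ c`
    have hpfc : (PowerSeries.C (p : ℤ_[p]) : IwasawaAlgebra p) ∣ f * c := by
      refine ⟨PowerSeries.C ((p : ℤ_[p]) ^ k) * g₀, ?_⟩
      rw [← hc, ← mul_assoc, ← map_mul, ← pow_succ']
    have hpf : ¬ (PowerSeries.C (p : ℤ_[p]) : IwasawaAlgebra p) ∣ f :=
      (hasUnitContent_iff_not_C_dvd f).mp hf
    rcases (IwasawaAlgebra.prime_C p).dvd_or_dvd hpfc with hpf' | ⟨c', rfl⟩
    · exact absurd hpf' hpf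
    · -- cancel `p`: `f · c' = p^k · g₀`
      have hp0 : (PowerSeries.C (p : ℤ_[p]) : IwasawaAlgebra p) ≠ 0 := (IwasawaAlgebra.prime_C p).ne_zero
      refine ih ⟨c', mul_left_cancel₀ hp0 ?_⟩
      calc PowerSeries.C (p : ℤ_[p]) * (PowerSeries.C ((p : ℤ_[p]) ^ k) * g₀)
          = PowerSeries.C ((p : ℤ_[p]) ^ (k + 1)) * g₀ := by
            rw [← mul_assoc, ← map_mul, ← pow_succ']
        _ = f * (PowerSeries.C (p : ℤ_[p]) * c') := hc
        _ = PowerSeries.C (p : ℤ_[p]) * (f * c') := by ring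

/-- **The RATIONAL λ-squeeze in `Λ`.** If `fE` and `g₀` have unit content, `fE ∣ p^k · g₀` and
`λ(g₀) ≤ λ(fE)`, then `(g₀) = (fE)` and `λ(g₀) = λ(fE)`: by Gauss' lemma `fE ∣ g₀`, and the integral
squeeze `span_eq_span_of_dvd_of_lam_le` applies. [cite: GreenbergVatsal2000, p. 4 (after Thm. (1.2))]
[cite: Washington1997, §7.1] -/
theorem span_eq_span_of_dvd_C_pow_mul_of_lam_le {fE g₀ : IwasawaAlgebra p} (hfE : HasUnitContent fE)
    (hg₀ : HasUnitContent g₀) {k : ℕ} (hdvd : fE ∣ PowerSeries.C ((p : ℤ_[p]) ^ k) * g₀)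
    (hle : lam g₀ ≤ lam fE) :
    Ideal.span ({g₀} : Set (IwasawaAlgebra p)) = Ideal.span {fE} ∧ lam g₀ = lam fE := by
  have hdvd' : fE ∣ g₀ := dvd_of_dvd_C_pow_mul_of_hasUnitContent hfE k hdvd
  refine ⟨span_eq_span_of_dvd_of_lam_le hg₀ hdvd' hle, le_antisymm hle ?_⟩
  obtain ⟨h, hfac⟩ := hdvd'
  have hg₀0 : g₀ ≠ 0 := ne_zero_of_hasUnitContent hg₀
  have hh0 : h ≠ 0 := by
    rintro rfl
    exact hg₀0 (by rw [hfac, mul_zero])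
  rw [hfac]
  exact lam_le_lam_mul (ne_zero_of_hasUnitContent hfE) hh0

/-! ### §2 The per-datum squeeze over `SelmerDualData` (cell-agnostic) -/

section Datum

variable {W : WeierstrassCurve ℚ} [W.IsElliptic] {κ : ZpExtension ℚ p} {γ : Field.absoluteGaloisGroup ℚ}

omit [W.IsElliptic] in
/-- The characteristic ideal of a Pontryagin-dual datum is principal and nonzero: `char X = (fE)`,
`fE ≠ 0` (`Λ` a UFD, `charIdeal_isPrincipal_holds`; `Module.charIdeal_ne_bot`).
[cite: Washington1997, §13.2] -/
theorem exists_charIdeal_eq_span_ne_zero (D : W.SelmerDualData κ γ) :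
    ∃ fE : IwasawaAlgebra p, D.charIdeal = Ideal.span {fE} ∧ fE ≠ 0 := by
  haveI : (Module.charIdeal (IwasawaAlgebra p) D.X).IsPrincipal := charIdeal_isPrincipal_holds p D.X
  obtain ⟨c, hc⟩ := Submodule.IsPrincipal.principal (Module.charIdeal (IwasawaAlgebra p) D.X)
  refine ⟨c, hc, fun h0 => Module.charIdeal_ne_bot (IwasawaAlgebra p) D.X ?_⟩
  rw [hc, h0]
  exact Ideal.span_singleton_eq_bot.mpr rfl

omit [W.IsElliptic] in
/-- **The per-datum RATIONAL SQUEEZE.** For a finitely generated torsion dual datum `D` of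
`Sel_{p^∞}(E/ℚ_∞)` with `μ(D.X) = 0`, an element `g ∈ char_Λ X` with `ι g = p^k · B`, `B ∈ ℚ_p⟦T⟧`
`p`-integral with a unit coefficient at index `n`, and `n ≤ λ(D.X)`: `B = ι g₀` for a `g₀ ∈ Λ` that
GENERATES `char_Λ X`, and `λ(D.X) = n`. (Generator `fE` of `char`; `μ(fE) = μ(X) = 0` ⟹ unit content;
`fE ∣ g = p^k g₀` ⟹ `fE ∣ g₀` by Gauss; `λ(g₀) ≤ n ≤ λ(X) = λ(fE)` squeezes.)
[cite: Washington1997, §13.2] [cite: GreenbergVatsal2000, p. 2–4] -/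
theorem exists_charIdeal_eq_span_of_ratDvd_of_cert_of_mu_zero_of_le
    (D : W.SelmerDualData κ γ) [Module.Finite (IwasawaAlgebra p) D.X] (hX : D.IsTorsion)
    (hμ : D.mu = 0) {g : IwasawaAlgebra p} (hg : g ∈ D.charIdeal) {k n : ℕ}
    {B : PowerSeries ℚ_[p]}
    (hι : iwasawaToPowerSeries p g = PowerSeries.C ((p : ℚ_[p]) ^ k) * B)
    (hint : ∀ j : ℕ, ‖PowerSeries.coeff j B‖ ≤ 1) (hn : ‖PowerSeries.coeff n B‖ = 1)
    (hge : n ≤ lambdaInvariant p D.X) :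
    ∃ g₀ : IwasawaAlgebra p, iwasawaToPowerSeries p g₀ = B ∧ D.charIdeal = Ideal.span {g₀} ∧
      lambdaInvariant p D.X = n ∧ lam g₀ = n := by
  obtain ⟨g₀, hg₀⟩ := exists_iwasawaToPowerSeries_eq_of_norm_coeff_le_one hint
  -- `g = p^k · g₀` in `Λ`
  have hgfac : g = PowerSeries.C ((p : ℤ_[p]) ^ k) * g₀ := by
    apply iwasawaToPowerSeries_injective p
    rw [hι, map_mul, Literature.NumberTheory.EllipticCurves.iwasawaToPowerSeries_C_natCast_pow p, hg₀]
  -- `g₀` has a unit coefficient at `n`: unit content and `λ(g₀) ≤ n`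
  have hn₀ : ‖(PowerSeries.coeff n g₀ : ℤ_[p])‖ = 1 := by
    rw [PadicInt.norm_def, ← Wuthrich2014.coeff_iwasawaToPowerSeries, hg₀, hn]
  have hu₀ : HasUnitContent g₀ := (hasUnitContent_iff_exists_norm_eq_one g₀).mpr ⟨n, hn₀⟩
  have hlam₀ : lam g₀ ≤ n := by
    rw [lam_eq_normLam hu₀]
    exact normLam_le_of_isMaxCoeffAt (isMaxCoeffAt_of_norm_eq_one hn₀)
  -- a generator `fE` of `char X`; `μ(fE) = μ(X) = 0` ⟹ unit content; `λ(fE) = λ(X)`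
  obtain ⟨fE, hchar, hfE0⟩ := exists_charIdeal_eq_span_ne_zero D
  have hμfE : mu fE = 0 := by
    rw [mu_generator_eq_muInvariant D.X hX hfE0 hchar]
    exact hμ
  have hufE : HasUnitContent fE := hasUnitContent_of_mu_eq_zero hfE0 hμfE
  have hlamfE : lam fE = lambdaInvariant p D.X := lam_generator_eq_lambdaInvariant D.X hX hfE0 hchar
  -- `fE ∣ g = p^k · g₀`
  have hdvd : fE ∣ PowerSeries.C ((p : ℤ_[p]) ^ k) * g₀ := by
    rw [← hgfac]
    rw [hchar] at hg
    exact Ideal.mem_span_singleton.mp hg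
  obtain ⟨hspan, hlam⟩ := span_eq_span_of_dvd_C_pow_mul_of_lam_le hufE hu₀ hdvd
    (hlam₀.trans (hlamfE ▸ hge))
  refine ⟨g₀, hg₀, hchar.trans hspan.symm, ?_, ?_⟩
  · exact le_antisymm (hlamfE ▸ hlam ▸ hlam₀) hge
  · exact le_antisymm hlam₀ (hlam ▸ hlamfE ▸ hge)

/-- **BUDGET form of the per-datum squeeze** (`W` globally minimal): the lower bound `n ≤ λ(D.X)` is
taken from the typed per-curve input `BudgetLeLambdaAt p W n` (K-F₀: "`μ(X) = 0 ⟹ n ≤ λ(X)`", the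
`p`-Tamagawa budget; `CongruentPartnerMainConjecture.lean`), fed by `μ(D.X) = 0`.
[cite: EmertonPollackWeston2006, Cor. 3.2.5 and Thm. 3.1.1 (shape of the budget input)]
[cite: Washington1997, §13.2] -/
theorem exists_charIdeal_eq_span_of_ratDvd_of_cert_of_mu_zero_of_budget [W.IsGloballyMinimal]
    {n : ℕ} (hbud : BudgetLeLambdaAt p W n)
    (hκ : κ.IsCyclotomic) (hγ : κ.IsTopGenerator γ) (hγ' : IsCyclotomicVariable p γ)
    (D : W.SelmerDualData κ γ) [Module.Finite (IwasawaAlgebra p) D.X] (hX : D.IsTorsion)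
    (hμ : D.mu = 0) {g : IwasawaAlgebra p} (hg : g ∈ D.charIdeal) {k : ℕ}
    {B : PowerSeries ℚ_[p]}
    (hι : iwasawaToPowerSeries p g = PowerSeries.C ((p : ℚ_[p]) ^ k) * B)
    (hint : ∀ j : ℕ, ‖PowerSeries.coeff j B‖ ≤ 1) (hn : ‖PowerSeries.coeff n B‖ = 1) :
    ∃ g₀ : IwasawaAlgebra p, iwasawaToPowerSeries p g₀ = B ∧ D.charIdeal = Ideal.span {g₀} ∧
      lambdaInvariant p D.X = n ∧ lam g₀ = n :=
  exists_charIdeal_eq_span_of_ratDvd_of_cert_of_mu_zero_of_le D hX hμ hg hι hint hn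
    (hbud hκ hγ hγ' D hX hμ)

omit [W.IsElliptic] in
/-- **`T = 0`, both halves at the datum, from `char X = (g₀)` with `ι g₀ = B`**: every `c ∈ char X`
has `c(0) = z · B(0)` with `z ∈ ℤ_p`, and `g₀ ∈ char X` has `g₀(0) = B(0)`. Pure bookkeeping.
[cite: MazurTateTeitelbaum1986Invent, §I.13–I.14 (constant term; shape)] -/
theorem constantCoeff_of_charIdeal_eq_span_of_iota_eq (D : W.SelmerDualData κ γ)
    {g₀ : IwasawaAlgebra p} {B : PowerSeries ℚ_[p]} (hg₀ : iwasawaToPowerSeries p g₀ = B)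
    (hchar : D.charIdeal = Ideal.span {g₀}) :
    (∀ c ∈ D.charIdeal, ∃ z : ℤ_[p],
        ((PowerSeries.constantCoeff c : ℤ_[p]) : ℚ_[p]) = (z : ℚ_[p]) * PowerSeries.constantCoeff B) ∧
      (g₀ ∈ D.charIdeal ∧
        ((PowerSeries.constantCoeff g₀ : ℤ_[p]) : ℚ_[p]) = PowerSeries.constantCoeff B) := by
  have h0 : ((PowerSeries.constantCoeff g₀ : ℤ_[p]) : ℚ_[p]) = PowerSeries.constantCoeff B := by
    rw [← constantCoeff_iwasawaToPowerSeries, hg₀]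
  refine ⟨fun c hc => ?_, ?_, h0⟩
  · rw [hchar] at hc
    obtain ⟨a, rfl⟩ := Ideal.mem_span_singleton'.mp hc
    exact ⟨PowerSeries.constantCoeff a, by rw [map_mul, PadicInt.coe_mul, h0]⟩
  · rw [hchar]
    exact Ideal.mem_span_singleton_self g₀

end Datum

/-! ### §3 The tame branch: Kato's half + ONE unit coefficient + the budget + the μ-anchor ⟹ the
rational main conjecture at the datum, INTEGRALLY (`k = 0`) -/

section TameBranch

variable {W : WeierstrassCurve ℚ} [W.IsElliptic] [W.IsGloballyMinimal]

/-- **ST-25.3 (the kernel lemma).** For `E = W` globally minimal, `p ≠ 2` additive of type (M) or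
(G-ord) — EVERY defect `e ∈ {2,3,4,6}` — the typed Kato half `TameBranchRatDvdAt W p` (Delbourgo 2002
Thm. (C)), a tame-branch tuple `(f, ε, α, B)` with `IsTameBranchOf f p ε α B`, `B` `p`-integral
(`hint`; the E-intrinsic `PlusSymbolsPIntegralAt` road of `TameBranchUpper.lean` on irreducible rows)
with ONE unit coefficient `‖[Tⁿ]B‖_p = 1` (`hn`, a finite `p`-adic computation), the `p`-Tamagawa
budget `BudgetLeLambdaAt p W n` (K-F₀) and, for the cyclotomic datum `D`, the μ-ANCHOR `μ(D.X) = 0`: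
then `char_Λ X(W/ℚ_∞) = (g₀)` with `ι g₀ = B` and `λ(X(W/ℚ_∞)) = n` — the per-datum conclusion of the
cell's typed rational main conjecture `TameBranchRatCharEqAt` with exponent `0`. On defect 2 compare
`budgetSqueeze` (integral Kato, μ forced); here the divisibility is rational and `μ = 0` is an INPUT.
X3♯/X4♯(G-ord) and (M) stay CONSTRUCTION-SHAPED; nothing booked.
[cite: Delbourgo2002, Theorem (C) (p. 40)] [cite: Delbourgo1998, Main Conjecture (p. 151) (shape)]
[cite: EmertonPollackWeston2006, Cor. 3.2.5 and Thm. 3.1.1 (shape of the budget input)]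
[cite: Washington1997, §13.2] -/
theorem tameBranch_charIdeal_eq_span_of_ratDvd_of_cert_of_budget_of_mu_zero
    (hT : TameBranchRatDvdAt W p)
    {N : ℕ} [NeZero N] {f : CuspForm (Gamma0 N) 2} {ε : DirichletCharacter ℂ_[p] p} {α : ℚ_[p]}
    {B : PowerSeries ℚ_[p]}
    (hp2 : p ≠ 2) (hadd : Addv W p) (hloc : PotMult W p ∨ TypeGOrd W p)
    (hf : IsNewformOf W f) (hε : orderOf ε = tameDefect W p) (hα : ‖α‖ = 1)
    (hB : IsTameBranchOf f p ε α B) (hint : ∀ j : ℕ, ‖PowerSeries.coeff j B‖ ≤ 1)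
    {n : ℕ} (hn : ‖PowerSeries.coeff n B‖ = 1) (hbud : BudgetLeLambdaAt p W n)
    {κ : ZpExtension ℚ p} {γ : Field.absoluteGaloisGroup ℚ} (hκ : κ.IsCyclotomic)
    (hγ : κ.IsTopGenerator γ) (hcv : IsCyclotomicVariable p γ)
    (D : W.SelmerDualData κ γ) [Module.Finite (IwasawaAlgebra p) D.X] (hμ : D.mu = 0) :
    D.IsTorsion ∧ ∃ g₀ : IwasawaAlgebra p, iwasawaToPowerSeries p g₀ = B ∧
      D.charIdeal = Ideal.span {g₀} ∧ lambdaInvariant p D.X = n := by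
  obtain ⟨hX, g, hg, k, hι⟩ := hT ε α B hp2 hadd hloc hκ hγ hcv hf hε hα hB D
  obtain ⟨g₀, hg₀, hchar, hlam, -⟩ :=
    exists_charIdeal_eq_span_of_ratDvd_of_cert_of_mu_zero_of_budget hbud hκ hγ hcv D hX hμ hg hι
      hint hn
  exact ⟨hX, g₀, hg₀, hchar, hlam⟩

/-- **The conclusion of §3 in the EXACT per-datum shape of `TameBranchRatCharEqAt`** (`∃ g k, char =
(g) ∧ ι g = p^k · B`, here with `k = 0`), for consumers written against that shape.
[cite: Delbourgo1998, Main Conjecture (p. 151) (shape)] [cite: Delbourgo2002, Theorem (C) (p. 40)] -/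
theorem tameBranch_ratCharEq_datum_of_ratDvd_of_cert_of_budget_of_mu_zero
    (hT : TameBranchRatDvdAt W p)
    {N : ℕ} [NeZero N] {f : CuspForm (Gamma0 N) 2} {ε : DirichletCharacter ℂ_[p] p} {α : ℚ_[p]}
    {B : PowerSeries ℚ_[p]}
    (hp2 : p ≠ 2) (hadd : Addv W p) (hloc : PotMult W p ∨ TypeGOrd W p)
    (hf : IsNewformOf W f) (hε : orderOf ε = tameDefect W p) (hα : ‖α‖ = 1)
    (hB : IsTameBranchOf f p ε α B) (hint : ∀ j : ℕ, ‖PowerSeries.coeff j B‖ ≤ 1)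
    {n : ℕ} (hn : ‖PowerSeries.coeff n B‖ = 1) (hbud : BudgetLeLambdaAt p W n)
    {κ : ZpExtension ℚ p} {γ : Field.absoluteGaloisGroup ℚ} (hκ : κ.IsCyclotomic)
    (hγ : κ.IsTopGenerator γ) (hcv : IsCyclotomicVariable p γ)
    (D : W.SelmerDualData κ γ) [Module.Finite (IwasawaAlgebra p) D.X] (hμ : D.mu = 0) :
    D.IsTorsion ∧ ∃ (g : IwasawaAlgebra p) (k : ℤ), D.charIdeal = Ideal.span {g} ∧
      iwasawaToPowerSeries p g = PowerSeries.C ((p : ℚ_[p]) ^ k) * B := by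
  obtain ⟨hX, g₀, hg₀, hchar, -⟩ :=
    tameBranch_charIdeal_eq_span_of_ratDvd_of_cert_of_budget_of_mu_zero hT hp2 hadd hloc hf hε hα hB
      hint hn hbud hκ hγ hcv D hμ
  exact ⟨hX, g₀, 0, hchar, by rw [zpow_zero, map_one, one_mul, hg₀]⟩

/-! ### §4 `T = 0`: BOTH halves at the datum -/

/-- **LOWER half at `T = 0`, at the datum** (the `D`-instance of n1011-p18's `CycLeadingTermDvdAt`):
under the hypotheses of §3 and the LOWER period binder of `TameBranchLower`
(`α⁻¹ · [0]⁺_f = z₀ · q`, `L(E,1) = q · Ω_E`), every `c ∈ char_Λ X(W/ℚ_∞)` has `c(0) = z · q` with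
`z ∈ ℤ_p` — "`L(E,1)/Ω_E ∣ c(0)`". [cite: Delbourgo1998, Main Conjecture (p. 151) (main-conjecture direction at T = 0; shape)]
[cite: MazurTateTeitelbaum1986Invent, §I.13–I.14 (constant term)] -/
theorem tameBranch_constantCoeff_dvd_of_ratDvd_of_cert_of_budget_of_mu_zero
    (hT : TameBranchRatDvdAt W p)
    {N : ℕ} [NeZero N] {f : CuspForm (Gamma0 N) 2} {ε : DirichletCharacter ℂ_[p] p} {α : ℚ_[p]}
    {B : PowerSeries ℚ_[p]}
    (hp2 : p ≠ 2) (hadd : Addv W p) (hloc : PotMult W p ∨ TypeGOrd W p)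
    (hf : IsNewformOf W f) (hε : orderOf ε = tameDefect W p) (hα : ‖α‖ = 1)
    (hB : IsTameBranchOf f p ε α B) (hint : ∀ j : ℕ, ‖PowerSeries.coeff j B‖ ≤ 1)
    {n : ℕ} (hn : ‖PowerSeries.coeff n B‖ = 1) (hbud : BudgetLeLambdaAt p W n)
    {q : ℚ} (hq : W.entireLFunction 1 = (q : ℂ) * (W.realPeriodRat : ℂ))
    {z₀ : ℤ_[p]} (h0 : α⁻¹ * (ratPlusSymbol f 0 : ℚ_[p]) = (z₀ : ℚ_[p]) * (q : ℚ_[p]))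
    {κ : ZpExtension ℚ p} {γ : Field.absoluteGaloisGroup ℚ} (hκ : κ.IsCyclotomic)
    (hγ : κ.IsTopGenerator γ) (hcv : IsCyclotomicVariable p γ)
    (D : W.SelmerDualData κ γ) [Module.Finite (IwasawaAlgebra p) D.X] (hμ : D.mu = 0) :
    ∀ c ∈ D.charIdeal, ∃ z : ℤ_[p], ∃ q : ℚ,
      W.entireLFunction 1 = (q : ℂ) * (W.realPeriodRat : ℂ) ∧
      ((PowerSeries.constantCoeff c : ℤ_[p]) : ℚ_[p]) = (z : ℚ_[p]) * (q : ℚ_[p]) := by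
  intro c hc
  obtain ⟨-, g₀, hg₀, hchar, -⟩ :=
    tameBranch_charIdeal_eq_span_of_ratDvd_of_cert_of_budget_of_mu_zero hT hp2 hadd hloc hf hε hα hB
      hint hn hbud hκ hγ hcv D hμ
  obtain ⟨hall, -, -⟩ := constantCoeff_of_charIdeal_eq_span_of_iota_eq D hg₀ hchar
  obtain ⟨z, hz⟩ := hall c hc
  refine ⟨z * z₀, q, hq, ?_⟩
  rw [hz, hB.constantCoeff, h0, PadicInt.coe_mul]
  ring

/-- **UPPER half at `T = 0`, at the datum** (the `D`-instance of additive-p2's `CycLeadingTermAt`):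
under the hypotheses of §3 and the UPPER (unit) period binder (`α⁻¹ · [0]⁺_f = u₀ · q` with
`u₀ ∈ ℤ_p^×`, `L(E,1) = q · Ω_E` — on the (G-ord)/(M) `r = 0` rows this is Birch × Pal / Manin, the
binder of `TameBranchUpper`), SOME `c ∈ char_Λ X(W/ℚ_∞)` — the generator `g₀` — has `c(0) = u₀ · q`.
[cite: Delbourgo1998, Main Conjecture (p. 151) (divisibility direction at T = 0; shape)]
[cite: MazurTateTeitelbaum1986Invent, §I.13–I.14 (constant term)] -/
theorem tameBranch_exists_constantCoeff_eq_unit_mul_of_ratDvd_of_cert_of_budget_of_mu_zero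
    (hT : TameBranchRatDvdAt W p)
    {N : ℕ} [NeZero N] {f : CuspForm (Gamma0 N) 2} {ε : DirichletCharacter ℂ_[p] p} {α : ℚ_[p]}
    {B : PowerSeries ℚ_[p]}
    (hp2 : p ≠ 2) (hadd : Addv W p) (hloc : PotMult W p ∨ TypeGOrd W p)
    (hf : IsNewformOf W f) (hε : orderOf ε = tameDefect W p) (hα : ‖α‖ = 1)
    (hB : IsTameBranchOf f p ε α B) (hint : ∀ j : ℕ, ‖PowerSeries.coeff j B‖ ≤ 1)
    {n : ℕ} (hn : ‖PowerSeries.coeff n B‖ = 1) (hbud : BudgetLeLambdaAt p W n)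
    {q : ℚ} (hq : W.entireLFunction 1 = (q : ℂ) * (W.realPeriodRat : ℂ))
    {u₀ : ℤ_[p]ˣ} (h0 : α⁻¹ * (ratPlusSymbol f 0 : ℚ_[p]) = ((u₀ : ℤ_[p]) : ℚ_[p]) * (q : ℚ_[p]))
    {κ : ZpExtension ℚ p} {γ : Field.absoluteGaloisGroup ℚ} (hκ : κ.IsCyclotomic)
    (hγ : κ.IsTopGenerator γ) (hcv : IsCyclotomicVariable p γ)
    (D : W.SelmerDualData κ γ) [Module.Finite (IwasawaAlgebra p) D.X] (hμ : D.mu = 0) :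
    ∃ c ∈ D.charIdeal, ∃ u : ℤ_[p]ˣ, ∃ q : ℚ,
      W.entireLFunction 1 = (q : ℂ) * (W.realPeriodRat : ℂ) ∧
      ((PowerSeries.constantCoeff c : ℤ_[p]) : ℚ_[p]) = ((u : ℤ_[p]) : ℚ_[p]) * (q : ℚ_[p]) := by
  obtain ⟨-, g₀, hg₀, hchar, -⟩ :=
    tameBranch_charIdeal_eq_span_of_ratDvd_of_cert_of_budget_of_mu_zero hT hp2 hadd hloc hf hε hα hB
      hint hn hbud hκ hγ hcv D hμ
  obtain ⟨-, hmem, h0g⟩ := constantCoeff_of_charIdeal_eq_span_of_iota_eq D hg₀ hchar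
  exact ⟨g₀, hmem, u₀, q, hq, by rw [h0g, hB.constantCoeff, h0]⟩

omit [W.IsElliptic] [W.IsGloballyMinimal] in
/-- **`λ(X(W/ℚ_∞)) = n` and the main conjecture on the tame branch are EQUIVALENT data modulo the
inputs of §3**: conversely to §3, if `char X = (g₀)` with `ι g₀ = B` and `‖[Tⁿ]B‖ = 1` is the FIRST unit
coefficient (`∀ j < n, ‖[Tʲ]B‖ < 1`), then `λ(X) = n` with NO budget and NO μ-input — so on a row where
the budget `n` is NOT the first unit index the inputs of §3 are inconsistent (a finite CHECK the
engine can run: anomaly protocol, not a theorem about BSD). [cite: Washington1997, §7.1, §13.2] -/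
theorem lambdaInvariant_eq_of_charIdeal_eq_span_of_iota_eq_of_first_unit_coeff
    {κ : ZpExtension ℚ p} {γ : Field.absoluteGaloisGroup ℚ}
    (D : W.SelmerDualData κ γ) [Module.Finite (IwasawaAlgebra p) D.X] (hX : D.IsTorsion)
    {g₀ : IwasawaAlgebra p} {B : PowerSeries ℚ_[p]} (hg₀ : iwasawaToPowerSeries p g₀ = B)
    (hchar : D.charIdeal = Ideal.span {g₀}) {n : ℕ} (hn : ‖PowerSeries.coeff n B‖ = 1)
    (hlt : ∀ j < n, ‖PowerSeries.coeff j B‖ < 1) : lambdaInvariant p D.X = n := by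
  have hcoeff : ∀ j, ‖(PowerSeries.coeff j g₀ : ℤ_[p])‖ = ‖PowerSeries.coeff j B‖ := fun j => by
    rw [PadicInt.norm_def, ← Wuthrich2014.coeff_iwasawaToPowerSeries, hg₀]
  have hn₀ : ‖(PowerSeries.coeff n g₀ : ℤ_[p])‖ = 1 := by rw [hcoeff, hn]
  have hu₀ : HasUnitContent g₀ := (hasUnitContent_iff_exists_norm_eq_one g₀).mpr ⟨n, hn₀⟩
  have hg₀0 : g₀ ≠ 0 := ne_zero_of_hasUnitContent hu₀
  rw [← lam_generator_eq_lambdaInvariant D.X hX hg₀0 hchar, lam_eq_normLam hu₀]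
  refine le_antisymm (normLam_le_of_isMaxCoeffAt (isMaxCoeffAt_of_norm_eq_one hn₀)) ?_
  by_contra hlt'
  push Not at hlt'
  have h1 : ‖(PowerSeries.coeff (normLam g₀) g₀ : ℤ_[p])‖ = 1 :=
    norm_coeff_normLam_eq_one ⟨n, hn₀⟩
  have := hlt (normLam g₀) hlt'
  rw [← hcoeff, h1] at this
  exact lt_irrefl _ this

end TameBranch

end Summit.BirchSwinnertonDyer.Rank1Residual.Additive

end
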